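import Literature.NumberTheory.Automorphic.UnitaryGroupTruncatedTraceClassPolynomialOfRows
import HarnessLib

/-!
# `J^T_𝔬(f)` is affine in `log T` on `U(J₂)`, class by class: the per-class polynomial from the rows
# (per-class parts identity + `δ_B`-homogeneity of `K_{B,𝔬}` + per-class integrability + the window-part integration)
(Arthur, *The trace formula in invariant form*, Ann. of Math. 114 (1981), Prop. 2.3 «`J^T_𝔬` is a polynomial in `T`»;
Rogawski, *Automorphic Representations of Unitary Groups in Three Variables* (1990), §2.3 p. 14, for the rank-one groups
`U(3)`, `U(2)`, `U(2) × U(1)` of §7.3 p. 98; Shokranian (1992), Thm. (5.7): degree `dim(A_B/A_G) = 1`.)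

Topic `NumberTheory/Automorphic`; namespace `Literature.NumberTheory.Automorphic.UnitaryGroup`. THEOREMS ONLY over
accepted tree modules: no definition, no named fact, no instance, no notation, no `sorry`. The `N = 2` sibling of ★
`UnitaryGroupTruncatedTraceClassPolynomialOfRows` (`truncatedTraceClassPolynomial_of_parts`), HYPOTHESES-FIRST in the
class inputs of the `N = 2` road AND — the one difference with the `N = 3` text — in the WINDOW-PART INTEGRATION `hwin`
(at `N = 3` this is the θ-generic ★ `exists_lintegral_weight_windowPart_eq` of `UnitaryGroupTruncatedTraceWindowParts`,
proved there from the Iwasawa exchange, the product weight `δ_B dℓb = dn dt` and the torus window integral; its `N = 2`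
twin is the LAW 2 engine of the H-side road, typed by the LAW 1–2 pens over ★ `UnitaryGroupLineUnipotentTwo` ∕
`UnitaryGroupBorelModulusTwo` ∕ `UnitaryGroupTorusSiegelSetTwo` and discharged into `hwin` by `exact`). H-SIDE copy of LAWS
1–5 (`H = U(Φ₂) × U(Φ₁)`; LEAD WORDs #123∕#124; census `CENSUS-LAWS-Hside.F0P3a-p03g6.md` §3 LAW 2∕LAW 3 «class rows
first») of the T1 line `Cruxes/H413/Lines/F0_T1InnerFormTraceIdentity.lean` (cell `pub/hodgecm-mathlib`, crux H413).

Hypotheses of **`truncatedTraceClassPolynomial_of_parts_two`**: `hunimod` (unimodularity of `U(J₂)(𝔸_F)`, ★-to-be H-B2);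
`cl : G(F) → ι`, `i : ι`; `hhom` — the `δ_B`-homogeneity `K_{B,𝔬}(b x, b y) = δ_B(b) • K_{B,𝔬}(x, y)` (row (C8) at
`N = 2`); `hparts` — the per-class parts identity (★ `exists_truncatedTraceClass_sub_eq_parts_two'`,
`UnitaryGroupTruncatedTraceClassDifferenceUnfoldingTwo`); `hint` — per-class integrability (★
`integrable_quotFun_truncatedKernelClass_of_cusp_estimate_two` + the per-class cusp estimate); `hwin` — for every Haar `ν_G`
on `G(𝔸_F)`, Haar `μ_K` on `K_U = G(𝔸) ∩ (K_∞ · GL₂(𝒪̂_E))` and covering weight `β` of `B(F)♯`, a constant `D` with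
`∫⁻ β · 1_{T<H≤T'} θ dν_G = D · (∫_{K_U} θ dμ_K) · (log T' − log T)` for every Borel `δ_B`-homogeneous `θ ≥ 0`, `0 < T ≤ T'`.
Conclusion: `J^T_𝔬(f) = p_𝔬(log T)` above the per-class integrability threshold, `deg p_𝔬 ≤ 1`.

* §1 `ofReal_apply_indicator_eq_indicator_two`, `ofReal_apply_kernelBorelClass_borel_mul_two` — the four parts of
  `K_{B,𝔬}(y,y)` are `δ_B`-homogeneous (from `hhom`).
* §2 **`truncatedTraceClassPolynomial_of_parts_two`**.

## References

* J. Arthur, *The trace formula in invariant form*, Ann. of Math. 114 (1981), Prop. 2.3 [Arthur1981TraceFormulaInvariantForm].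
* J. D. Rogawski, *Automorphic Representations of Unitary Groups in Three Variables*, Ann. of Math. Stud. 123 (1990), §2.3
  (p. 14), §7.3 (p. 98) [Rogawski1990].
* S. Shokranian, *The Selberg–Arthur Trace Formula*, LNM 1503 (1992), Thm. (5.7), Rem. (5.8) [Shokranian1992].
-/

set_option autoImplicit false

noncomputable section

open MeasureTheory Measure NumberField IsDedekindDomain Set Polynomial Literature.MeasureTheory.Group
open scoped NNReal ENNReal Pointwise

namespace Literature.NumberTheory.Automorphic

namespace UnitaryGroup

variable {F E : Type} [Field F] [NumberField F] [Field E] [NumberField E] [Algebra F E]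
  {c : E ≃ₐ[F] E} {ι : Type*}

/-! ## §1 The four parts of `K_{B,𝔬}(y, y)` are `δ_B`-homogeneous (`U(J₂)`) -/

section Parts

variable [MeasurableSpace (adelicUnipotent F E c 2)]

omit [MeasurableSpace (adelicUnipotent F E c 2)] in
/-- `ofReal (φ ((1_W K)(y))) = 1_W (ofReal ∘ φ ∘ K) (y)` for any `φ : ℂ → ℝ` with `φ 0 = 0` (the four parts `±re, ±im`),
on `U(J₂)(𝔸_F)`. [cite: Rogawski1990, §2.2 (p. 13)] -/
theorem ofReal_apply_indicator_eq_indicator_two {W : Set (quasiSplit F E c 2).Adelic}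
    {K : (quasiSplit F E c 2).Adelic → ℂ} {φ : ℂ → ℝ} (hφ : φ 0 = 0) (y : (quasiSplit F E c 2).Adelic) :
    ENNReal.ofReal (φ (W.indicator K y)) = W.indicator (fun y => ENNReal.ofReal (φ (K y))) y := by
  by_cases hy : y ∈ W
  · rw [Set.indicator_of_mem hy, Set.indicator_of_mem hy]
  · rw [Set.indicator_of_notMem hy, Set.indicator_of_notMem hy, hφ, ENNReal.ofReal_zero]

/-- **The four parts of the diagonal class Borel kernel of `U(J₂)` are `δ_B`-homogeneous**, granted the homogeneity
`K_{B,𝔬}(b x, b y) = δ_B(b) • K_{B,𝔬}(x, y)` (row (C8) at `N = 2`): for any real-linear `φ` (the parts `±re, ±im`),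
`ofReal (φ (K_{B,𝔬}(b k, b k))) = δ_B(b) · ofReal (φ (K_{B,𝔬}(k, k)))`. [cite: Rogawski1990, §2.2 (p. 13)] -/
theorem ofReal_apply_kernelBorelClass_borel_mul_two {ν : Measure (adelicUnipotent F E c 2)}
    {𝓕 : Set (adelicUnipotent F E c 2)} {cl : (quasiSplit F E c 2).arithmeticSubgroup → ι} {i : ι}
    {f : (quasiSplit F E c 2).Adelic → ℂ}
    (hhom : ∀ (b : borelAdelic F E c 2) (x y : (quasiSplit F E c 2).Adelic),
      kernelBorelClass ν 𝓕 cl i f ((b : (quasiSplit F E c 2).Adelic) * x) ((b : (quasiSplit F E c 2).Adelic) * y) =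
        (torusRootModulus E 2 (diagUnit b.2) : ℝ) • kernelBorelClass ν 𝓕 cl i f x y)
    {φ : ℂ → ℝ} (hφ : ∀ (r : ℝ) (z : ℂ), φ ((r : ℂ) * z) = r * φ z)
    (b : borelAdelic F E c 2) (k : (quasiSplit F E c 2).Adelic) :
    ENNReal.ofReal (φ (kernelBorelClass ν 𝓕 cl i f ((b : (quasiSplit F E c 2).Adelic) * k)
      ((b : (quasiSplit F E c 2).Adelic) * k))) =
      ((torusRootModulus E 2 (diagUnit b.2) : ℝ≥0) : ℝ≥0∞) * ENNReal.ofReal (φ (kernelBorelClass ν 𝓕 cl i f k k)) := by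
  rw [hhom b k k, Complex.real_smul, hφ, ENNReal.ofReal_mul (NNReal.coe_nonneg _), ENNReal.ofReal_coe_nnreal]

end Parts

/-! ## §2 The per-class polynomial (`U(J₂)`) -/

/-- **`J^T_𝔬(f)` IS AFFINE IN `log T` ON `U(J₂)`, FROM THE ROWS.** Hypotheses: unimodularity of `U(J₂)(𝔸_F)` (`hunimod`); a
class map `cl` (any `ι`) and an index `i`; the `δ_B`-homogeneity `hhom` of `K_{B,𝔬}` for every Haar `ν` and fundamental
domain `𝓕` (row (C8)); the per-class parts identity `hparts` with ONE constant `C` for all windows (★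
`exists_truncatedTraceClass_sub_eq_parts_two'`); the per-class integrability `hint`; and the WINDOW-PART INTEGRATION `hwin`
(the `N = 2` LAW 2 engine: `∫⁻ β · 1_{T<H≤T'} θ = D · ∫_{K_U} θ · (log T' − log T)` for Borel `δ_B`-homogeneous `θ ≥ 0`).
Conclusion: for every Haar measure `ν` of `N(𝔸_F)`, fundamental domain `𝓕`, automorphic measure `μ` and quasi-split test
function `f` there is `p ∈ ℂ[X]` of degree `≤ 1` with `J^T_𝔬(f) = p(log T)` for all large `T`.
[cite: Arthur1981TraceFormulaInvariantForm, Prop. 2.3] [cite: Rogawski1990, §2.3 (p. 14)]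
[cite: Shokranian1992, Thm. (5.7) and Rem. (5.8)] -/
theorem truncatedTraceClassPolynomial_of_parts_two
    (hunimod : ∀ [MeasurableSpace (quasiSplit F E c 2).Adelic] [BorelSpace (quasiSplit F E c 2).Adelic]
      (νG : Measure (quasiSplit F E c 2).Adelic), νG.IsHaarMeasure → νG.IsMulRightInvariant)
    (cl : (quasiSplit F E c 2).arithmeticSubgroup → ι) (i : ι)
    (hhom : ∀ [MeasurableSpace (adelicUnipotent F E c 2)] [BorelSpace (adelicUnipotent F E c 2)]
      (ν : Measure (adelicUnipotent F E c 2)) [ν.IsHaarMeasure] (𝓕 : Set (adelicUnipotent F E c 2)),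
      IsFundamentalDomain (rationalUnipotent F E c 2) 𝓕 ν →
      ∀ (f : (quasiSplit F E c 2).Adelic → ℂ), Continuous f → HasCompactSupport f →
      ∀ (b : borelAdelic F E c 2) (x y : (quasiSplit F E c 2).Adelic),
        kernelBorelClass ν 𝓕 cl i f ((b : (quasiSplit F E c 2).Adelic) * x) ((b : (quasiSplit F E c 2).Adelic) * y) =
          (torusRootModulus E 2 (diagUnit b.2) : ℝ) • kernelBorelClass ν 𝓕 cl i f x y)
    (hparts : ∀ [MeasurableSpace (adelicUnipotent F E c 2)] [BorelSpace (adelicUnipotent F E c 2)]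
      [MeasurableSpace (quasiSplit F E c 2).Adelic] [BorelSpace (quasiSplit F E c 2).Adelic]
      (ν : Measure (adelicUnipotent F E c 2)) [ν.IsHaarMeasure] (𝓕 : Set (adelicUnipotent F E c 2)),
      IsFundamentalDomain (rationalUnipotent F E c 2) 𝓕 ν →
      ∀ (μ : Measure (quasiSplit F E c 2).automorphicQuotient) [(quasiSplit F E c 2).IsAutomorphicMeasure μ]
        (νG : Measure (quasiSplit F E c 2).Adelic) [νG.IsHaarMeasure] [νG.IsInvInvariant]
        (f : (quasiSplit F E c 2).Adelic → ℂ), Continuous f → HasCompactSupport f →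
      ∀ (β : (quasiSplit F E c 2).Adelic → ℝ≥0∞),
        IsCoveringWeight ((arithmeticBorel F E c 2).map (quasiSplit F E c 2).arithmeticSubgroup.subtype) β →
      ∃ C : ℝ≥0∞, C ≠ ⊤ ∧ ∀ T T' : ℝ≥0, 1 ≤ T → T ≤ T' →
        Integrable ((quasiSplit F E c 2).quotFun (truncatedKernelClass ν 𝓕 T cl i f)) μ →
        Integrable ((quasiSplit F E c 2).quotFun (truncatedKernelClass ν 𝓕 T' cl i f)) μ →
        truncatedTraceClass μ ν 𝓕 T' cl i f - truncatedTraceClass μ ν 𝓕 T cl i f =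
          (((C * ∫⁻ y, β y * ENNReal.ofReal
              ({y : (quasiSplit F E c 2).Adelic | T < borelHeight y ∧ borelHeight y ≤ T'}.indicator
                (fun y => kernelBorelClass ν 𝓕 cl i f y y) y).re ∂νG).toReal -
            (C * ∫⁻ y, β y * ENNReal.ofReal
              (-({y : (quasiSplit F E c 2).Adelic | T < borelHeight y ∧ borelHeight y ≤ T'}.indicator
                (fun y => kernelBorelClass ν 𝓕 cl i f y y) y).re) ∂νG).toReal : ℝ) : ℂ) +
          (((C * ∫⁻ y, β y * ENNReal.ofReal
              ({y : (quasiSplit F E c 2).Adelic | T < borelHeight y ∧ borelHeight y ≤ T'}.indicator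
                (fun y => kernelBorelClass ν 𝓕 cl i f y y) y).im ∂νG).toReal -
            (C * ∫⁻ y, β y * ENNReal.ofReal
              (-({y : (quasiSplit F E c 2).Adelic | T < borelHeight y ∧ borelHeight y ≤ T'}.indicator
                (fun y => kernelBorelClass ν 𝓕 cl i f y y) y).im) ∂νG).toReal : ℝ) : ℂ) * Complex.I)
    (hint : ∀ [MeasurableSpace (adelicUnipotent F E c 2)] [BorelSpace (adelicUnipotent F E c 2)]
      (ν : Measure (adelicUnipotent F E c 2)) [ν.IsHaarMeasure] (𝓕 : Set (adelicUnipotent F E c 2)),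
      IsFundamentalDomain (rationalUnipotent F E c 2) 𝓕 ν →
      ∀ (μ : Measure (quasiSplit F E c 2).automorphicQuotient) [(quasiSplit F E c 2).IsAutomorphicMeasure μ]
        (f : (quasiSplit F E c 2).Adelic → ℂ), IsQuasiSplitTest F E c 2 f →
      ∃ T₀ : ℝ≥0, ∀ T : ℝ≥0, T₀ < T →
        Integrable ((quasiSplit F E c 2).quotFun (truncatedKernelClass ν 𝓕 T cl i f)) μ)
    (hwin : ∀ [MeasurableSpace (quasiSplit F E c 2).Adelic] [BorelSpace (quasiSplit F E c 2).Adelic]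
      (νG : Measure (quasiSplit F E c 2).Adelic) [νG.IsHaarMeasure]
      (μK : Measure ((standardMaximalCompactGL 2 E).comap
        (adelicVal F E c 2 ((StdForm.antidiagonal 2).over E)) : Subgroup (quasiSplit F E c 2).Adelic))
      [μK.IsHaarMeasure]
      (β : (quasiSplit F E c 2).Adelic → ℝ≥0∞),
      IsCoveringWeight ((arithmeticBorel F E c 2).map (quasiSplit F E c 2).arithmeticSubgroup.subtype) β →
      ∃ D : ℝ≥0∞, ∀ θ : (quasiSplit F E c 2).Adelic → ℝ≥0∞, Measurable θ →
        (∀ (b : borelAdelic F E c 2) (k : (quasiSplit F E c 2).Adelic),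
          adelicVal F E c 2 ((StdForm.antidiagonal 2).over E) k ∈ standardMaximalCompactGL 2 E →
          θ ((b : (quasiSplit F E c 2).Adelic) * k) = ((torusRootModulus E 2 (diagUnit b.2) : ℝ≥0) : ℝ≥0∞) * θ k) →
        ∀ T T' : ℝ≥0, 0 < T → T ≤ T' →
          ∫⁻ y, β y * {y : (quasiSplit F E c 2).Adelic | T < borelHeight y ∧ borelHeight y ≤ T'}.indicator θ y ∂νG =
            D * (∫⁻ k, θ (k : (quasiSplit F E c 2).Adelic) ∂μK) *
              ENNReal.ofReal (Real.log (T' : ℝ) - Real.log (T : ℝ))) :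
    ∀ [MeasurableSpace (adelicUnipotent F E c 2)] [BorelSpace (adelicUnipotent F E c 2)]
      (ν : Measure (adelicUnipotent F E c 2)) [ν.IsHaarMeasure] (𝓕 : Set (adelicUnipotent F E c 2)),
      IsFundamentalDomain (rationalUnipotent F E c 2) 𝓕 ν →
      ∀ (μ : Measure (quasiSplit F E c 2).automorphicQuotient) [(quasiSplit F E c 2).IsAutomorphicMeasure μ]
        (f : (quasiSplit F E c 2).Adelic → ℂ), IsQuasiSplitTest F E c 2 f →
      ∃ p : ℂ[X], p.natDegree ≤ 1 ∧ ∃ T₀ : ℝ≥0, ∀ T : ℝ≥0, T₀ < T →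
        truncatedTraceClass μ ν 𝓕 T cl i f = p.eval ((Real.log (T : ℝ) : ℝ) : ℂ) := by
  intro mN bN ν hν 𝓕 h𝓕 μ hμ f hf
  classical
  -- structure on `G(𝔸)`: Borel σ-algebra, Haar measure (right and inversion invariant by unimodularity)
  haveI := secondCountableTopology_adeleRing E
  haveI := locallyCompactSpace_adeleRing' E
  haveI := t2Space_adeleRing_of_numberField E
  haveI : T2Space (quasiSplit F E c 2).Adelic :=
    inferInstanceAs (T2Space (adelic F E c 2 ((StdForm.antidiagonal 2).over E)))
  haveI : LocallyCompactSpace (quasiSplit F E c 2).Adelic :=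
    inferInstanceAs (LocallyCompactSpace (adelic F E c 2 ((StdForm.antidiagonal 2).over E)))
  haveI : SecondCountableTopology (quasiSplit F E c 2).Adelic :=
    inferInstanceAs (SecondCountableTopology (adelic F E c 2 ((StdForm.antidiagonal 2).over E)))
  letI : MeasurableSpace (quasiSplit F E c 2).Adelic := borel _
  haveI : BorelSpace (quasiSplit F E c 2).Adelic := ⟨rfl⟩
  obtain ⟨K₀⟩ := (inferInstance : Nonempty (TopologicalSpace.PositiveCompacts (quasiSplit F E c 2).Adelic))
  set νG : Measure (quasiSplit F E c 2).Adelic := Measure.haarMeasure K₀ with hνG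
  haveI : νG.IsMulRightInvariant := hunimod νG inferInstance
  haveI : νG.IsInvInvariant := isInvInvariant_of_isMulRightInvariant νG
  -- Haar measure on the compact `K_U`
  haveI : CompactSpace ((standardMaximalCompactGL 2 E).comap
      (adelicVal F E c 2 ((StdForm.antidiagonal 2).over E)) : Subgroup (quasiSplit F E c 2).Adelic) :=
    isCompact_iff_compactSpace.1 isCompact_comap_adelicVal_standardMaximalCompactGL
  set μK : Measure ((standardMaximalCompactGL 2 E).comap
      (adelicVal F E c 2 ((StdForm.antidiagonal 2).over E)) : Subgroup (quasiSplit F E c 2).Adelic) :=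
    Measure.haar with hμK
  -- `N(𝔸_F)` closed: second countable, locally compact, `ν` s-finite (for the measurability of `K_B`)
  have hNcl : IsClosed ((adelicUnipotent F E c 2 : Set (quasiSplit F E c 2).Adelic)) := by
    change IsClosed (⇑(adelicVal F E c 2 ((StdForm.antidiagonal 2).over E)) ⁻¹'
      ((upperUnitriangular (Fin 2) (AdeleRing (𝓞 E) E) : Subgroup (GL (Fin 2) (AdeleRing (𝓞 E) E))) :
        Set (GL (Fin 2) (AdeleRing (𝓞 E) E))))
    exact (isClosed_upperUnitriangular (R := AdeleRing (𝓞 E) E)).preimage continuous_subtype_val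
  haveI : SecondCountableTopology (adelicUnipotent F E c 2) := TopologicalSpace.Subtype.secondCountableTopology _
  haveI : LocallyCompactSpace (adelicUnipotent F E c 2) := hNcl.locallyCompactSpace
  haveI : SFinite ν := inferInstance
  -- the data
  have hfc : Continuous f := hf.continuous'
  have hfs : HasCompactSupport f := hf.hasCompactSupport'
  obtain ⟨T₀, hT₀⟩ := hint ν 𝓕 h𝓕 μ f hf
  obtain ⟨β, hβ⟩ := exists_isCoveringWeight_arithmeticBorel_map (F := F) (E := E) (c := c) (N := 2)
  obtain ⟨Cu, -, hparts'⟩ := hparts ν 𝓕 h𝓕 μ νG f hfc hfs β hβ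
  obtain ⟨D, hD⟩ := hwin νG μK β hβ
  -- the four homogeneous parts and their `K_U`-masses
  have hKm : Measurable fun y : (quasiSplit F E c 2).Adelic => kernelBorelClass ν 𝓕 cl i f y y :=
    measurable_kernelBorelClass_diag hfc ν 𝓕 cl i
  have hlin_re : ∀ (r : ℝ) (z : ℂ), (fun z : ℂ => z.re) ((r : ℂ) * z) = r * (fun z : ℂ => z.re) z := fun r z => by
    simp
  have hlin_nre : ∀ (r : ℝ) (z : ℂ), (fun z : ℂ => -z.re) ((r : ℂ) * z) = r * (fun z : ℂ => -z.re) z := fun r z => by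
    simp
  have hlin_im : ∀ (r : ℝ) (z : ℂ), (fun z : ℂ => z.im) ((r : ℂ) * z) = r * (fun z : ℂ => z.im) z := fun r z => by
    simp
  have hlin_nim : ∀ (r : ℝ) (z : ℂ), (fun z : ℂ => -z.im) ((r : ℂ) * z) = r * (fun z : ℂ => -z.im) z := fun r z => by
    simp
  -- the common identity for one part `φ ∈ {re, −re, im, −im}`
  have hpart : ∀ (φ : ℂ → ℝ), φ 0 = 0 → Measurable φ → (∀ (r : ℝ) (z : ℂ), φ ((r : ℂ) * z) = r * φ z) →
      ∀ T T' : ℝ≥0, 0 < T → T ≤ T' →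
        ∫⁻ y, β y * ENNReal.ofReal (φ ({y : (quasiSplit F E c 2).Adelic | T < borelHeight y ∧ borelHeight y ≤ T'}.indicator
          (fun y => kernelBorelClass ν 𝓕 cl i f y y) y)) ∂νG =
        D * (∫⁻ k, ENNReal.ofReal (φ (kernelBorelClass ν 𝓕 cl i f (k : (quasiSplit F E c 2).Adelic) (k : (quasiSplit F E c 2).Adelic))) ∂μK) *
          ENNReal.ofReal (Real.log (T' : ℝ) - Real.log (T : ℝ)) := by
    intro φ hφ0 hφm hφl T T' hT hTT'
    have hθm : Measurable fun y : (quasiSplit F E c 2).Adelic => ENNReal.ofReal (φ (kernelBorelClass ν 𝓕 cl i f y y)) :=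
      ENNReal.measurable_ofReal.comp (hφm.comp hKm)
    have h := hD (fun y => ENNReal.ofReal (φ (kernelBorelClass ν 𝓕 cl i f y y))) hθm
      (fun b k _ => ofReal_apply_kernelBorelClass_borel_mul_two (hhom ν 𝓕 h𝓕 f hfc hfs) hφl b k) T T' hT hTT'
    rw [← h]
    refine lintegral_congr fun y => ?_
    rw [ofReal_apply_indicator_eq_indicator_two hφ0]
  -- `J^{T'} − J^{T} = D_f (log T' − log T)` for `T₁ < T ≤ T'`, `T₁ = max T₀ 1`
  set a₁ : ℝ := (Cu * (D * ∫⁻ k, ENNReal.ofReal ((kernelBorelClass ν 𝓕 cl i f (k : (quasiSplit F E c 2).Adelic)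
    (k : (quasiSplit F E c 2).Adelic)).re) ∂μK)).toReal with ha₁
  set a₂ : ℝ := (Cu * (D * ∫⁻ k, ENNReal.ofReal (-(kernelBorelClass ν 𝓕 cl i f (k : (quasiSplit F E c 2).Adelic)
    (k : (quasiSplit F E c 2).Adelic)).re) ∂μK)).toReal with ha₂
  set a₃ : ℝ := (Cu * (D * ∫⁻ k, ENNReal.ofReal ((kernelBorelClass ν 𝓕 cl i f (k : (quasiSplit F E c 2).Adelic)
    (k : (quasiSplit F E c 2).Adelic)).im) ∂μK)).toReal with ha₃
  set a₄ : ℝ := (Cu * (D * ∫⁻ k, ENNReal.ofReal (-(kernelBorelClass ν 𝓕 cl i f (k : (quasiSplit F E c 2).Adelic)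
    (k : (quasiSplit F E c 2).Adelic)).im) ∂μK)).toReal with ha₄
  set Df : ℂ := ((a₁ - a₂ : ℝ) : ℂ) + ((a₃ - a₄ : ℝ) : ℂ) * Complex.I with hDf
  have hdiff : ∀ T T' : ℝ≥0, max T₀ 1 < T → T ≤ T' →
      truncatedTraceClass μ ν 𝓕 T' cl i f - truncatedTraceClass μ ν 𝓕 T cl i f =
        Df * (((Real.log (T' : ℝ) - Real.log (T : ℝ) : ℝ)) : ℂ) := by
    intro T T' hT hTT'
    have hT1 : 1 ≤ T := le_of_lt (lt_of_le_of_lt (le_max_right _ _) hT)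
    have hT0 : 0 < T := lt_of_lt_of_le one_pos hT1
    have hTT₀ : T₀ < T := lt_of_le_of_lt (le_max_left _ _) hT
    have hlog : 0 ≤ Real.log (T' : ℝ) - Real.log (T : ℝ) :=
      sub_nonneg.2 (Real.log_le_log (NNReal.coe_pos.2 hT0) (NNReal.coe_le_coe.2 hTT'))
    have hid := hparts' T T' hT1 hTT' (hT₀ T hTT₀) (hT₀ T' (lt_of_lt_of_le hTT₀ hTT'))
    rw [hid, hpart (fun z => z.re) rfl Complex.measurable_re hlin_re T T' hT0 hTT',
      hpart (fun z => -z.re) (by simp) Complex.measurable_re.neg hlin_nre T T' hT0 hTT',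
      hpart (fun z => z.im) rfl Complex.measurable_im hlin_im T T' hT0 hTT',
      hpart (fun z => -z.im) (by simp) Complex.measurable_im.neg hlin_nim T T' hT0 hTT']
    simp only [← mul_assoc, ENNReal.toReal_mul, ENNReal.toReal_ofReal hlog]
    rw [hDf, ha₁, ha₂, ha₃, ha₄]
    simp only [ENNReal.toReal_mul]
    push_cast
    ring
  -- the polynomial
  set T₂ : ℝ≥0 := max T₀ 1 + 1 with hT₂
  have hT₂gt : max T₀ 1 < T₂ := by rw [hT₂]; exact lt_add_one _
  refine ⟨Polynomial.C Df * Polynomial.X + Polynomial.C (truncatedTraceClass μ ν 𝓕 T₂ cl i f - Df * ((Real.log (T₂ : ℝ) : ℝ) : ℂ)),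
    Polynomial.natDegree_linear_le, max T₀ 1, fun T hT => ?_⟩
  rw [Polynomial.eval_add, Polynomial.eval_mul, Polynomial.eval_C, Polynomial.eval_X, Polynomial.eval_C]
  rcases le_total T T₂ with hle | hle
  · have h := hdiff T T₂ hT hle
    have : truncatedTraceClass μ ν 𝓕 T cl i f = truncatedTraceClass μ ν 𝓕 T₂ cl i f - Df * (((Real.log (T₂ : ℝ) - Real.log (T : ℝ) : ℝ)) : ℂ) := by
      rw [← h]; ring
    rw [this]
    push_cast
    ring
  · have h := hdiff T₂ T hT₂gt hle
    have : truncatedTraceClass μ ν 𝓕 T cl i f = truncatedTraceClass μ ν 𝓕 T₂ cl i f + Df * (((Real.log (T : ℝ) - Real.log (T₂ : ℝ) : ℝ)) : ℂ) := by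
      rw [← h]; ring
    rw [this]
    push_cast
    ring

end UnitaryGroup

end Literature.NumberTheory.Automorphic
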